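import Mathlib
import Summits.Ventures.PercRepro2.UniversalFlow2Good

/-! # `SP.Good`, decided
(seat mine-b, cell pub-perc-repro2; MINE-B.md §26.7) -/

namespace Summit.Ventures.PercRepro2.V2Closure

/-- `SP.Good` as a Boolean function -/
def SP.good : SP → Bool
  | .free => true
  | .pin => true
  | .absent => true
  | .ser s t => decide (s.flow ≤ 2) || decide (t.flow ≤ 2)
  | .par s t => s.good && t.good

/-- **`good` decides `Good`** -/
theorem SP.good_spec : ∀ s : SP, s.good = true → s.Good
  | .free, _ => trivial
  | .pin, _ => trivial
  | .absent, _ => trivial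
  | .ser s t, h => by
    simp only [SP.good, Bool.or_eq_true, decide_eq_true_eq] at h
    exact h
  | .par s t, h => by
    simp only [SP.good, Bool.and_eq_true] at h
    exact ⟨SP.good_spec s h.1, SP.good_spec t h.2⟩

end Summit.Ventures.PercRepro2.V2Closure
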